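import Literature.Probability.LatticeModels.DobrushinComparisonBoundary
import HarnessLib

/-!
# Dobrushin's comparison of two finite-volume kernels whose boundary conditions differ on an ARBITRARY set
# (Georgii 2011 Thm. 8.20; Föllmer 1988 Ch. I (2.10); Dobrushin 1970 Thm. 3)

Sibling proof file of `DobrushinComparisonBoundary.lean` (same namespace), which treats boundary conditions
differing at ONE exterior site `y ∉ Λ` (`abs_kernel_sub_le_of_superSolution`). Dobrushin's Theorem 3 (1970) and
Georgii's Theorem 8.20 compare the kernels `γ_Λ(·|ω)`, `γ_Λ(·|η)` of one specification under Dobrushin's condition for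
two ARBITRARY boundary conditions: `|γ_Λ(f|ω) − γ_Λ(f|η)| ≤ Σ_{x ∈ Λ} δ_x(f) Σ_{y ∉ Λ} D_{xy} 𝟙[ω_y ≠ η_y]`,
`D = Σ_n (C_Λ)^n C`. This file proves that statement in the super-solution form of the sibling file (Vasserstein
weight `r ≤ R`, Föllmer's sweep `DustingData.abs_sub_le_sum_of_superSolution_of_estimate`):

* `abs_sub_le_sum_filter_of_dependsOn` — interpolation over the coordinates where two configurations DIFFER
  (`|f σ − f τ| ≤ Σ_{y ∈ Δ, σ_y ≠ τ_y} δ_y r(σ_y, τ_y)`; the weight need not vanish on the diagonal);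
* `isEstimate_kernel_pair_of_ne` — the initial estimate `R·𝟙_Λ + r(ω_z, η_z)·𝟙_{z ∉ Λ, ω_z ≠ η_z}` for the pair of
  kernels (properness; Föllmer 1988 Ch. I (2.3), (2.22));
* ★ `abs_kernel_sub_le_of_superSolution_of_ne` — for every `d ≥ 0` with `Σ_{z ∈ nbr x} C x z d_z ≤ d_x` on `Λ` and
  `d_z ≥ 1` at every exterior site where `ω ≠ η`, the `Λ`-restricted row sums being `≤ c < 1`:
  `|∫ f dγ_Λ(·|ω) − ∫ f dγ_Λ(·|η)| ≤ R Σ_{z ∈ Δ} d_z δ_z(f)` for bounded measurable `f` depending on `Δ` with Lipschitz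
  vector `δ` (Georgii 2011 Thm. 8.20 with `d ≥ (I − C_{ΛΛ})⁻¹ C 𝟙_{ω ≠ η}`).

No named fact is introduced; every statement is proved (D-0026).

References: R. L. Dobrushin, Theory Probab. Appl. 15 (1970) 458–486, Thm. 3; H. Föllmer, LNM 1362 (1988) Ch. I,
(2.3), (2.10), (2.22); H.-O. Georgii, *Gibbs Measures and Phase Transitions*, 2nd ed. (2011), Thm. 8.20, Remark 8.26.
-/

noncomputable section

open MeasureTheory ProbabilityTheory Finset Function Filter

namespace Literature.Probability.LatticeModels

namespace DobrushinMetric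

variable {V S : Type*} [MeasurableSpace S] {γ : Specification V S} {r : S → S → ℝ}
  {nbr : V → Finset V} {C : V → V → ℝ}

omit [MeasurableSpace S] in
/-- Interpolation over the sites where two configurations DIFFER: if `f` depends on `Δ` and `δ` bounds its
coordinatewise `r`-Lipschitz constants, `|f σ − f τ| ≤ Σ_{y ∈ Δ, σ_y ≠ τ_y} δ_y r(σ_y, τ_y)` (change the differing
coordinates one at a time; the weight `r` need not vanish on the diagonal). [cite: Follmer1988, Ch. I Remark (2.17)] -/
theorem abs_sub_le_sum_filter_of_dependsOn [DecidableEq V] {f : (V → S) → ℝ} {Δ : Finset V} {δ : V → ℝ}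
    (hdep : DependsOn f (↑Δ : Set V)) (hδ : IsLipBound r f δ) (σ τ : V → S) [DecidablePred fun y => σ y ≠ τ y] :
    |f σ - f τ| ≤ ∑ y ∈ Δ.filter (fun y => σ y ≠ τ y), δ y * r (σ y) (τ y) := by
  have h : ∀ s : Finset V, |f σ - f (s.piecewise τ σ)| ≤ ∑ y ∈ s, δ y * r (σ y) (τ y) := by
    intro s
    induction s using Finset.induction_on with
    | empty => simp
    | insert y s hy ih =>
      rw [Finset.sum_insert hy]
      have hstep : |f (s.piecewise τ σ) - f ((insert y s).piecewise τ σ)| ≤ δ y * r (σ y) (τ y) := by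
        have h1 : (s.piecewise τ σ) y = σ y := Finset.piecewise_eq_of_notMem _ _ _ hy
        have h2 : ((insert y s).piecewise τ σ) y = τ y :=
          Finset.piecewise_eq_of_mem _ _ _ (Finset.mem_insert_self y s)
        have h := hδ.le y (s.piecewise τ σ) ((insert y s).piecewise τ σ) fun z hz => by
          rw [Finset.piecewise_insert_of_ne _ _ _ hz]
        rwa [h1, h2] at h
      calc |f σ - f ((insert y s).piecewise τ σ)|
          ≤ |f σ - f (s.piecewise τ σ)| + |f (s.piecewise τ σ) - f ((insert y s).piecewise τ σ)| :=
            abs_sub_le _ _ _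
        _ ≤ (∑ y ∈ s, δ y * r (σ y) (τ y)) + δ y * r (σ y) (τ y) := add_le_add ih hstep
        _ = δ y * r (σ y) (τ y) + ∑ y ∈ s, δ y * r (σ y) (τ y) := add_comm _ _
  have hT : f ((Δ.filter fun y => σ y ≠ τ y).piecewise τ σ) = f τ := hdep fun i hi => by
    by_cases hst : σ i = τ i
    · rw [Finset.piecewise_eq_of_notMem _ _ _ (by simp [hst]), hst]
    · exact Finset.piecewise_eq_of_mem _ _ _ (Finset.mem_filter.2 ⟨Finset.mem_coe.1 hi, hst⟩)
  simpa [hT] using h (Δ.filter fun y => σ y ≠ τ y)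

/-- Two averages of a function with oscillation `≤ K` under probability measures differ by at most `K`. [folklore] -/
private theorem abs_integral_sub_integral_le_of_osc' {μ ν : Measure (V → S)} [IsProbabilityMeasure μ]
    [IsProbabilityMeasure ν] {h : (V → S) → ℝ} (hm : Measurable h) {B : ℝ} (hB : ∀ σ, |h σ| ≤ B)
    {K : ℝ} (hosc : ∀ σ τ, |h σ - h τ| ≤ K) :
    |(∫ σ, h σ ∂μ) - ∫ τ, h τ ∂ν| ≤ K := by
  have hiμ : Integrable h μ := integrable_of_abs_le' hm hB
  have hiν : Integrable h ν := integrable_of_abs_le' hm hB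
  have hpt : ∀ σ, |h σ - ∫ τ, h τ ∂ν| ≤ K := fun σ => by
    have e : h σ - ∫ τ, h τ ∂ν = ∫ τ, (h σ - h τ) ∂ν := by
      rw [integral_sub (integrable_const _) hiν, integral_const, smul_eq_mul, probReal_univ, one_mul]
    rw [e]
    calc |∫ τ, (h σ - h τ) ∂ν| ≤ ∫ τ, |h σ - h τ| ∂ν := abs_integral_le_integral_abs
      _ ≤ ∫ _τ, K ∂ν := integral_mono ((integrable_const _).sub hiν).abs (integrable_const K)
          fun τ => hosc σ τ
      _ = K := by simp
  have e : (∫ σ, h σ ∂μ) - ∫ τ, h τ ∂ν = ∫ σ, (h σ - ∫ τ, h τ ∂ν) ∂μ := by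
    rw [integral_sub hiμ (integrable_const _), integral_const, smul_eq_mul, probReal_univ, one_mul]
  rw [e]
  calc |∫ σ, (h σ - ∫ τ, h τ ∂ν) ∂μ| ≤ ∫ σ, |h σ - ∫ τ, h τ ∂ν| ∂μ := abs_integral_le_integral_abs
    _ ≤ ∫ _σ, K ∂μ := integral_mono (hiμ.sub (integrable_const _)).abs (integrable_const K) hpt
    _ = K := by simp

open Classical in
/-- **The initial estimate for two arbitrary boundary conditions** (Föllmer 1988 Ch. I (2.3), (2.22); Georgii 2011
Thm. 8.20, first step): for the kernels `γ_Λ(·|ω)`, `γ_Λ(·|η)` the vector `R·𝟙_Λ + r(ω_z, η_z)·𝟙_{z ∉ Λ, ω_z ≠ η_z}` is an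
estimate — by properness both kernels freeze the outside, so `f` may be replaced by its `η`-outside version at cost
`Σ_{z ∉ Λ, ω_z ≠ η_z} δ_z r(ω_z, η_z)` under the first kernel, and two averages of a function of the inside spins differ by
at most its oscillation `R Σ_{z ∈ Λ} δ_z`. [cite: Georgii2011, Thm. 8.20] -/
theorem isEstimate_kernel_pair_of_ne [DecidableEq V] (hγ : IsSpecification γ) (hC : IsKRContraction γ r nbr C)
    {R : ℝ} (hr0 : ∀ a b, 0 ≤ r a b) (hrR : ∀ a b, r a b ≤ R) (hR : 0 ≤ R) (Λ : Finset V) (ω η : V → S) :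
    (krDustingData hγ hC hr0 hrR hR (↑Λ : Set V)).IsEstimate (fun f => ∫ σ, f σ ∂(γ Λ ω))
      (fun f => ∫ σ, f σ ∂(γ Λ η))
      fun z => if z ∈ Λ then R else if ω z = η z then 0 else r (ω z) (η z) := by
  intro f Δ δ hf hδ hδ0
  obtain ⟨hfm, hfdep, B, hB⟩ := hf
  haveI := hγ.isProbability Λ ω
  haveI := hγ.isProbability Λ η
  -- inside versions of `f` with the outside frozen to `ξ`
  set glue : (V → S) → (V → S) → V → S := fun ξ σ z => if z ∈ Λ then σ z else ξ z with hglue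
  have hglm : ∀ ξ, Measurable (glue ξ) := fun ξ => by
    refine measurable_pi_iff.2 fun z => ?_
    by_cases hz : z ∈ Λ
    · simp only [hglue, if_pos hz]; exact measurable_pi_apply z
    · simp only [hglue, if_neg hz]; exact measurable_const
  set g : (V → S) → ℝ := fun σ => f (glue ω σ) with hg
  set h : (V → S) → ℝ := fun σ => f (glue η σ) with hh
  have hgm : Measurable g := hfm.comp (hglm ω)
  have hhm : Measurable h := hfm.comp (hglm η)
  have hfi : ∀ ξ, Integrable f (γ Λ ξ) := fun ξ => by
    haveI := hγ.isProbability Λ ξ; exact integrable_of_abs_le' hfm hB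
  have hgi : Integrable g (γ Λ ω) := integrable_of_abs_le' hgm fun σ => hB _
  have hhi : ∀ ξ, Integrable h (γ Λ ξ) := fun ξ => by
    haveI := hγ.isProbability Λ ξ; exact integrable_of_abs_le' hhm fun σ => hB _
  -- properness: under `γ_Λ(·|ξ)`, `f = f ∘ glue ξ` a.e.
  have hprop : ∀ ξ, ∫ σ, f σ ∂(γ Λ ξ) = ∫ σ, f (glue ξ σ) ∂(γ Λ ξ) := fun ξ => by
    refine integral_congr_ae ?_
    filter_upwards [hγ.proper Λ ξ] with σ hσ
    congr 1
    funext z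
    by_cases hz : z ∈ Λ
    · simp only [hglue, if_pos hz]
    · simp only [hglue, if_neg hz]; exact hσ z hz
  -- Step 1: `|g − h| ≤ Σ_{z ∈ Δ, z ∉ Λ, ω z ≠ η z} δ_z r(ω_z, η_z)` pointwise
  set T : Finset V := Δ.filter fun z => z ∉ Λ ∧ ω z ≠ η z with hT
  have hgh : ∀ σ, |g σ - h σ| ≤ ∑ z ∈ T, δ z * r (ω z) (η z) := fun σ => by
    have key := abs_sub_le_sum_filter_of_dependsOn hfdep hδ (glue ω σ) (glue η σ)
    refine key.trans (le_of_eq ?_)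
    have hset : (Δ.filter fun y => glue ω σ y ≠ glue η σ y) = T := by
      ext z
      simp only [hT, Finset.mem_filter, hglue]
      by_cases hz : z ∈ Λ <;> simp [hz]
    rw [hset]
    refine Finset.sum_congr rfl fun z hz => ?_
    have hz' : z ∉ Λ := ((Finset.mem_filter.1 hz).2).1
    simp only [hglue, if_neg hz']
    rfl
  -- Step 2: `h` is a function of the inside spins with oscillation `≤ R Σ_{z ∈ Δ ∩ Λ} δ_z`
  have hhLip : IsLipBound r h fun z => if z ∈ Λ then δ z else 0 := by
    refine ⟨fun z => by split_ifs; exacts [hδ.nonneg z, le_rfl], fun z σ τ hστ => ?_⟩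
    by_cases hz : z ∈ Λ
    · rw [if_pos hz]
      have hgl : ∀ w, w ≠ z → glue η σ w = glue η τ w := fun w hw => by
        by_cases hwΛ : w ∈ Λ
        · simp only [hglue, if_pos hwΛ]; exact hστ w hw
        · simp only [hglue, if_neg hwΛ]
      have h1 := hδ.le z _ _ hgl
      simp only [hglue, if_pos hz] at h1
      exact h1
    · rw [if_neg hz, zero_mul]
      have hst : glue η σ = glue η τ := by
        funext w
        by_cases hwΛ : w ∈ Λ
        · simp only [hglue, if_pos hwΛ]; exact hστ w fun h' => hz (h' ▸ hwΛ)
        · simp only [hglue, if_neg hwΛ]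
      simp [hh, hst]
  have hhdep : DependsOn h (↑Δ : Set V) := fun σ τ hστ => hfdep fun z hz => by
    by_cases hzΛ : z ∈ Λ
    · simp only [hglue, if_pos hzΛ]; exact hστ z hz
    · simp only [hglue, if_neg hzΛ]
  have hosc : ∀ σ τ, |h σ - h τ| ≤ R * ∑ z ∈ Δ, (if z ∈ Λ then δ z else 0) :=
    abs_sub_le_mul_sum_of_dependsOn hrR hhdep hhLip
  have h2 : |(∫ σ, h σ ∂(γ Λ ω)) - ∫ σ, h σ ∂(γ Λ η)| ≤ R * ∑ z ∈ Δ, (if z ∈ Λ then δ z else 0) :=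
    abs_integral_sub_integral_le_of_osc' hhm (fun σ => hB _) hosc
  -- Step 1 integrated
  have h1 : |(∫ σ, g σ ∂(γ Λ ω)) - ∫ σ, h σ ∂(γ Λ ω)| ≤ ∑ z ∈ T, δ z * r (ω z) (η z) := by
    rw [← integral_sub hgi (hhi ω)]
    calc |∫ σ, (g σ - h σ) ∂(γ Λ ω)| ≤ ∫ σ, |g σ - h σ| ∂(γ Λ ω) := abs_integral_le_integral_abs
      _ ≤ ∫ _σ, ∑ z ∈ T, δ z * r (ω z) (η z) ∂(γ Λ ω) :=
          integral_mono (hgi.sub (hhi ω)).abs (integrable_const _) hgh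
      _ = ∑ z ∈ T, δ z * r (ω z) (η z) := by simp
  -- assemble
  show |(∫ σ, f σ ∂(γ Λ ω)) - ∫ σ, f σ ∂(γ Λ η)| ≤
    ∑ y ∈ Δ, (if y ∈ Λ then R else if ω y = η y then 0 else r (ω y) (η y)) * δ y
  rw [hprop ω, hprop η]
  change |(∫ σ, g σ ∂(γ Λ ω)) - ∫ σ, h σ ∂(γ Λ η)| ≤ _
  calc |(∫ σ, g σ ∂(γ Λ ω)) - ∫ σ, h σ ∂(γ Λ η)|
      ≤ |(∫ σ, g σ ∂(γ Λ ω)) - ∫ σ, h σ ∂(γ Λ ω)| + |(∫ σ, h σ ∂(γ Λ ω)) - ∫ σ, h σ ∂(γ Λ η)| :=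
        abs_sub_le _ _ _
    _ ≤ (∑ z ∈ T, δ z * r (ω z) (η z)) + R * ∑ z ∈ Δ, (if z ∈ Λ then δ z else 0) := add_le_add h1 h2
    _ = ∑ z ∈ Δ, (if z ∈ Λ then R else if ω z = η z then 0 else r (ω z) (η z)) * δ z := by
        rw [hT, Finset.sum_filter, Finset.mul_sum, ← Finset.sum_add_distrib]
        refine Finset.sum_congr rfl fun z _ => ?_
        by_cases hzΛ : z ∈ Λ
        · simp [hzΛ]
        · by_cases hωη : ω z = η z
          · simp [hzΛ, hωη]
          · simp [hzΛ, hωη, mul_comm]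

open Classical in
/-- ★ **Dobrushin's comparison of two finite-volume kernels, boundary conditions differing on a SET** (Georgii 2011
Thm. 8.20; Föllmer 1988 Ch. I (2.10); Dobrushin 1970 Thm. 3 — the tree's `abs_kernel_sub_le_of_superSolution` is the
one-site case). Let `γ` satisfy Dobrushin's condition in the Vasserstein form (`IsKRContraction γ r nbr C`, `0 ≤ r ≤ R`),
`Λ` finite, `ω, η` ANY two boundary conditions, and let `d ≥ 0` be a super-solution on `Λ`,
`Σ_{z ∈ nbr x} C x z · d_z ≤ d_x` for `x ∈ Λ`, with `d_z ≥ 1` at every exterior site where `ω ≠ η`, the `Λ`-restricted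
row sums being `≤ c < 1`. Then for bounded measurable `f` depending on `Δ` with Lipschitz vector `δ`:
`|∫ f dγ_Λ(·|ω) − ∫ f dγ_Λ(·|η)| ≤ R · Σ_{z ∈ Δ} d_z δ_z`. [cite: Georgii2011, Thm. 8.20] -/
theorem abs_kernel_sub_le_of_superSolution_of_ne [DecidableEq V] (hγ : IsSpecification γ)
    (hC : IsKRContraction γ r nbr C) {R : ℝ} (hr0 : ∀ a b, 0 ≤ r a b) (hrR : ∀ a b, r a b ≤ R)
    (hR : 0 ≤ R) (Λ : Finset V) (ω η : V → S) {d : V → ℝ} (hd0 : ∀ z, 0 ≤ d z)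
    (hd1 : ∀ z, z ∉ Λ → ω z ≠ η z → 1 ≤ d z)
    (hsol : ∀ x ∈ Λ, ∑ z ∈ nbr x, C x z * d z ≤ d x) {c : ℝ} (hc0 : 0 ≤ c) (hc1 : c < 1)
    (hrowW : ∀ x ∈ Λ, ∑ z ∈ nbr x, (if z ∈ Λ then C x z else 0) ≤ c)
    {f : (V → S) → ℝ} (hfm : Measurable f) {Δ : Finset V} (hfdep : DependsOn f (↑Δ : Set V))
    {M : ℝ} (hM : ∀ σ, |f σ| ≤ M) {δ : V → ℝ} (hδ : IsLipBound r f δ) :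
    |(∫ σ, f σ ∂(γ Λ ω)) - ∫ σ, f σ ∂(γ Λ η)| ≤ R * ∑ z ∈ Δ, d z * δ z := by
  set D := krDustingData hγ hC hr0 hrR hR (↑Λ : Set V) with hD
  have h₁ := isInvariantState_kernel hγ hC hr0 hrR hR Λ ω
  have h₂ := isInvariantState_kernel hγ hC hr0 hrR hR Λ η
  have ha := isEstimate_kernel_pair_of_ne hγ hC hr0 hrR hR Λ ω η
  have hrowC : ∀ (a : V → ℝ) (x : V), D.rowC a x = ∑ z ∈ nbr x, C x z * a z := fun a x => by
    change ∑ z ∈ nbr x, (if z ∈ nbr x then C x z else 0) * a z = _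
    exact Finset.sum_congr rfl fun z hz => by rw [if_pos hz]
  have key := DustingData.abs_sub_le_sum_of_superSolution_of_estimate h₁ h₂ ha
    (fun z => by
      show 0 ≤ (if z ∈ Λ then R else if ω z = η z then 0 else r (ω z) (η z))
      split_ifs; exacts [hR, le_rfl, hr0 _ _])
    (astar := fun z => R * d z)
    (fun x hx => by
      rw [hrowC]
      have hx' : x ∈ Λ := hx
      calc ∑ z ∈ nbr x, C x z * (R * d z) = R * ∑ z ∈ nbr x, C x z * d z := by
            rw [Finset.mul_sum]; exact Finset.sum_congr rfl fun z _ => by ring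
        _ ≤ R * d x := mul_le_mul_of_nonneg_left (hsol x hx') hR)
    (M := R) hR
    (fun z => by
      show (if z ∈ Λ then R else if ω z = η z then 0 else r (ω z) (η z)) ≤
        R * Set.indicator D.W 1 z + R * d z
      by_cases hzΛ : z ∈ Λ
      · rw [if_pos hzΛ, Set.indicator_of_mem (show z ∈ D.W from Finset.mem_coe.2 hzΛ), Pi.one_apply, mul_one]
        exact le_add_of_nonneg_right (mul_nonneg hR (hd0 z))
      · rw [if_neg hzΛ, Set.indicator_of_notMem (show z ∉ D.W from fun h' => hzΛ (Finset.mem_coe.1 h')),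
          mul_zero, zero_add]
        by_cases hωη : ω z = η z
        · rw [if_pos hωη]; exact mul_nonneg hR (hd0 z)
        · rw [if_neg hωη]
          exact (hrR _ _).trans (le_mul_of_one_le_right hR (hd1 z hzΛ hωη)))
    hc0 hc1
    (fun x hx => by
      rw [hrowC]
      have hx' : x ∈ Λ := hx
      refine le_trans (le_of_eq (Finset.sum_congr rfl fun z _ => ?_)) (hrowW x hx')
      by_cases hzΛ : z ∈ Λ
      · rw [if_pos hzΛ, Set.indicator_of_mem (show z ∈ D.W from Finset.mem_coe.2 hzΛ), Pi.one_apply, mul_one]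
      · rw [if_neg hzΛ, Set.indicator_of_notMem (show z ∉ D.W from fun h' => hzΛ (Finset.mem_coe.1 h')),
          mul_zero])
    (f := f) (Δ := Δ) ⟨hfm, hfdep, M, hM⟩ (hδ.restrict hfdep) (fun z hz => if_neg hz)
  refine key.trans (le_of_eq ?_)
  rw [Finset.mul_sum]
  refine Finset.sum_congr rfl fun z hz => ?_
  rw [if_pos hz]
  ring

end DobrushinMetric

end Literature.Probability.LatticeModels

end
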